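import Mathlib
import HarnessLib
import Summits.AnomalousDissipation.AnomalousDissipation.Theses.DyadicWallCascade
import Summits.AnomalousDissipation.AnomalousDissipation.Theorems.DyadicWallCascadeDyadicRealisationZeroStress

/-!
# Sketch (crux-ideate round 2, ideator 4) — crux `DyadicWallCascade.ViscousContinuation`
  (stmt-AnomalousDissipation-17917)

Two groups of checked / elaborating statements.

§1 THE ZERO-STRESS FACTORISATION (kernel-checked, no sorry).  The landed theorem
`stub_zeroStress` (Theorems/DyadicWallCascadeDyadicRealisationZeroStress.lean) says that the
hierarchy re-quantified in `ViscousWallProfile` always has zero Reynolds stress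
`∫ V₂V₀ = ∫ V₂V₁ = 0` on the unit square of `z = 1`.  The hypothesis `HalfSpaceHierarchy` of the crux
does not (the stress `τ_h` is a free modulus of the hierarchy class: the lattice point group maps
`τ ↦ (±τ₁, ±τ₂), (±τ₂, ±τ₁)`, never to `0`, and hierarchies cannot be superposed).  Hence the crux
FACTORS EXACTLY as
  `ViscousContinuation ↔ (HalfSpaceHierarchy → ZeroStressHierarchy) ∧ (ZeroStressHierarchy → ViscousWallProfile)`
(`viscousContinuation_iff_split`): an Euler-side "stress removal" statement (Grad-class: no
mechanism short of constructing a zero-stress hierarchy outright, i.e. ⊇ crux #2 with symmetry)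
and the continuation of a ZERO-STRESS hierarchy.  Consequence for the planners: as typed, every
constructive line for 17917 must contain a stub implying `ZeroStressHierarchy` (hence crux #2) —
the round-1 "costume of 17919" verdicts are forced by the typing; re-cut #2 := `ZeroStressHierarchy`
(or its p4m-symmetric strengthening) and #3 := `ZeroStressContinuation`.

§2 FIRST LEMMAS of card `coercive-hydraulic-partition` (statements; `CoerciveLoop` is PROVED):
the flux-partition loop of TRIAGE-r1-1 P4 / r1-3 E2′ is two-way but has a SIGN — the cap's
injection-to-pressure response is a positive operator (Stokes slip layer: `StokesLayerPassivity`,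
exact energy identity; steady NS: `NSLayerHeadPassivity`, exact for the total head) and a junction
whose outlet fluxes decrease with outlet back-pressure has a positive-semidefinite (graph-Laplacian)
response `G`; then `1 + G N` is invertible for ALL positive-semidefinite `G`, `N` (`CoerciveLoop`,
proved below), i.e. `1 ∉ spec Γ` for `Γ = -G N` at every level, whatever the (level-dependent,
large) norm of the Hele-Shaw stiffness `N`.
-/

noncomputable section

set_option linter.dupNamespace false

namespace Summit.AnomalousDissipation.AnomalousDissipation.Cruxes.ViscousContinuation.SketchR2K4

open MeasureTheory Set Filter Topology
open scoped Matrix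
open Summit.AnomalousDissipation.AnomalousDissipation.Theses.DyadicWallCascade
open Summit.AnomalousDissipation.AnomalousDissipation.Theorems

/-- Local notation: Euclidean 3-space (index `2` is the vertical coordinate). -/
local notation "E³" => EuclideanSpace ℝ (Fin 3)

/-! ## §1 The zero-stress factorisation of the crux -/

/-- The clause block of `HalfSpaceHierarchy`, verbatim (as in Disproof.lean §0). -/
def HierarchyBody (V : E³ → E³) (Q : E³ → ℝ) (C F : ℝ) : Prop :=
  let H : Set (EuclideanSpace ℝ (Fin 3)) := {X | 0 < X 2}
  let e : Fin 3 → EuclideanSpace ℝ (Fin 3) := fun i => EuclideanSpace.single i (1 : ℝ)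
  let pt : ℝ × ℝ → EuclideanSpace ℝ (Fin 3) := fun q => !₂[q.1, q.2, (1 : ℝ)]
  ContDiffOn ℝ ((⊤ : ℕ∞) : WithTop ℕ∞) V H ∧ ContDiffOn ℝ ((⊤ : ℕ∞) : WithTop ℕ∞) Q H ∧
  (∀ X ∈ H, ‖V X‖ ≤ C ∧ |Q X| ≤ C) ∧ (∀ X ∈ H, ∑ i : Fin 3, (fderiv ℝ V X (e i)) i = 0) ∧
  (∀ X ∈ H, (fderiv ℝ V X) (V X) + gradient Q X = 0) ∧
  (∀ X ∈ H, V ((2 : ℝ) • X) = V X ∧ Q ((2 : ℝ) • X) = Q X) ∧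
  (∀ X : EuclideanSpace ℝ (Fin 3), 1 ≤ X 2 → X 2 ≤ 2 →
    V (X + e 0) = V X ∧ V (X + e 1) = V X ∧ Q (X + e 0) = Q X ∧ Q (X + e 1) = Q X) ∧
  (∫ q in Set.Icc (0 : ℝ) 1 ×ˢ Set.Icc (0 : ℝ) 1, (V (pt q)) 2 = 0) ∧ F ≠ 0 ∧
  (∫ q in Set.Icc (0 : ℝ) 1 ×ˢ Set.Icc (0 : ℝ) 1, (V (pt q)) 2 * (‖V (pt q)‖ ^ 2 / 2 + Q (pt q)) = F)

/-- The viscous block of `ViscousWallProfile` (clauses on `(W, P)` incl. the blow-down), verbatim. -/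
def ViscousBody (W : E³ → E³) (P : E³ → ℝ) (V : E³ → E³) (Q : E³ → ℝ) (C' : ℝ) : Prop :=
  let e : Fin 3 → EuclideanSpace ℝ (Fin 3) := fun i => EuclideanSpace.single i (1 : ℝ)
  let σ : EuclideanSpace ℝ (Fin 3) → EuclideanSpace ℝ (Fin 3) := fun X => X - (2 * X 2) • e 2
  ContDiff ℝ ((⊤ : ℕ∞) : WithTop ℕ∞) W ∧ ContDiff ℝ ((⊤ : ℕ∞) : WithTop ℕ∞) P ∧
  (∀ X, ‖W X‖ ≤ C' ∧ |P X| ≤ C') ∧ (∀ X, W (σ X) = σ (W X) ∧ P (σ X) = P X) ∧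
  (∀ X, ∑ i : Fin 3, (fderiv ℝ W X (e i)) i = 0) ∧
  (∀ X, (fderiv ℝ W X) (W X) + gradient P X = ∑ i : Fin 3, fderiv ℝ (fun Y => fderiv ℝ W Y (e i)) X (e i)) ∧
  (∀ ε : ℝ, 0 < ε → ∃ M : ℕ, ∀ m : ℕ, M ≤ m → ∀ X : EuclideanSpace ℝ (Fin 3), 1 ≤ X 2 → X 2 ≤ 2 →
    ‖W ((2 : ℝ) ^ m • X) - V X‖ ≤ ε ∧ |P ((2 : ℝ) ^ m • X) - Q X| ≤ ε)

/-- Zero Reynolds stress of the trace on the unit square of the plane `z = 1`: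
`∫ V₂V₀ = ∫ V₂V₁ = 0` — the two conclusions of the landed `stub_zeroStress`. -/
def ZeroStress (V : E³ → E³) : Prop :=
  (∫ q in Set.Icc (0 : ℝ) 1 ×ˢ Set.Icc (0 : ℝ) 1,
      (V !₂[q.1, q.2, (1 : ℝ)]) 2 * (V !₂[q.1, q.2, (1 : ℝ)]) 0 = 0) ∧
  (∫ q in Set.Icc (0 : ℝ) 1 ×ˢ Set.Icc (0 : ℝ) 1,
      (V !₂[q.1, q.2, (1 : ℝ)]) 2 * (V !₂[q.1, q.2, (1 : ℝ)]) 1 = 0)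

/-- **Zero-stress half-space hierarchy**: crux #2's clauses plus zero Reynolds stress of the blow-down
trace.  The recommended re-typing of crux #2 (`HalfSpaceHierarchy`) for the route: it is what
`ViscousWallProfile` actually delivers (below) and what crux #3 actually needs. -/
def ZeroStressHierarchy : Prop := ∃ V Q C F, HierarchyBody V Q C F ∧ ZeroStress V

/-- Euler-side factor of the crux: SOME hierarchy ⇒ a ZERO-STRESS hierarchy (Grad-class; no known
mechanism short of an outright construction, since `τ_h` is a free modulus of the class). -/
def StressRemoval : Prop := HalfSpaceHierarchy → ZeroStressHierarchy

/-- Navier–Stokes-side factor of the crux: a zero-stress hierarchy continues to a viscous wall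
profile (the recommended re-cut of item 17917). -/
def ZeroStressContinuation : Prop := ZeroStressHierarchy → ViscousWallProfile

theorem halfSpaceHierarchy_iff : HalfSpaceHierarchy ↔ ∃ V Q C F, HierarchyBody V Q C F := Iff.rfl

theorem viscousWallProfile_iff :
    ViscousWallProfile ↔ ∃ W P V Q C F C', HierarchyBody V Q C F ∧ ViscousBody W P V Q C' := Iff.rfl

/-- A zero-stress hierarchy is a hierarchy. -/
theorem zeroStressHierarchy_imp_halfSpaceHierarchy : ZeroStressHierarchy → HalfSpaceHierarchy := by
  rintro ⟨V, Q, C, F, hH, -⟩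
  exact ⟨V, Q, C, F, hH⟩

/-- **The conclusion of the crux delivers a ZERO-STRESS hierarchy** (landed `stub_zeroStress`). -/
theorem viscousWallProfile_imp_zeroStressHierarchy : ViscousWallProfile → ZeroStressHierarchy := by
  rw [viscousWallProfile_iff]
  rintro ⟨W, P, V, Q, C, F, C', hH, hV⟩
  refine ⟨V, Q, C, F, hH, ?_⟩
  obtain ⟨hVs, hQs, hbdd, hdiv, hEul, hdil, hper, hmass, hF, hflux⟩ := hH
  obtain ⟨hWs, hPs, hWb, hmir, hWdiv, hNS, hbd⟩ := hV
  exact stub_zeroStress W P V Q C F C'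
    ⟨⟨hVs, hQs, hbdd, hdiv, hEul, hdil, hper, hmass, hF, hflux⟩, hWs, hPs, hWb, hmir, hWdiv, hNS, hbd⟩

/-- **Hidden Euler-side content of the crux**: it implies stress removal. -/
theorem viscousContinuation_imp_stressRemoval : ViscousContinuation → StressRemoval :=
  fun h h2 => viscousWallProfile_imp_zeroStressHierarchy (h h2)

/-- The crux also implies the zero-stress continuation (trivially). -/
theorem viscousContinuation_imp_zeroStressContinuation : ViscousContinuation → ZeroStressContinuation :=
  fun h hz => h (zeroStressHierarchy_imp_halfSpaceHierarchy hz)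

/-- **Exact factorisation of the crux** into an Euler-side (Grad-class) factor and the continuation
of a zero-stress hierarchy.  Every constructive line for the crux AS TYPED therefore proves
`StressRemoval`, i.e. contains a stub ⊇ `ZeroStressHierarchy` ⊇ crux #2. -/
theorem viscousContinuation_iff_split :
    ViscousContinuation ↔ (StressRemoval ∧ ZeroStressContinuation) :=
  ⟨fun h => ⟨viscousContinuation_imp_stressRemoval h, viscousContinuation_imp_zeroStressContinuation h⟩,
    fun ⟨hr, hc⟩ h2 => hc (hr h2)⟩

/-- After the recommended re-cut (#2 := `ZeroStressHierarchy`) the route's deciding theorem keeps its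
shape: the two ν-free items and `DyadicRealisation` still reach the summit (through the landed
`steadyToSummit_proof`, exactly as `closes` does today). -/
theorem closes_recut (h₂ : ZeroStressHierarchy) (h₃ : ZeroStressContinuation) (h₄ : DyadicRealisation) :
    _root_.AnomalousDissipation := by
  have hS := Summit.AnomalousDissipation.AnomalousDissipation.Theorems.steadyToSummit_proof
  unfold Summit.AnomalousDissipation.AnomalousDissipation.Theses.SteadyWeakLimit.SteadyToSummit at hS
  exact hS (h₄ (h₃ h₂))

/-! ## §2 First lemmas of card `coercive-hydraulic-partition` -/

/-- **Coercive loop lemma** (finite-dimensional core of the card; PROVED): for positive-semidefinite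
real matrices `G` (junction response: outlet fluxes decrease with outlet back-pressure, zero row
sums — a weighted graph Laplacian) and `N` (cap response: injection ↦ footprint pressure, positive
by the layer energy identity), `1 + G * N` is injective, hence invertible: the flux-partition loop
`Γ = -G N` never has `1` in its spectrum, whatever the size of `‖N‖` (the Hele-Shaw stiffness
`3L²/h³` grows without bound with the level). [folklore] -/
theorem coerciveLoop {n : Type*} [Fintype n] [DecidableEq n] (G N : Matrix n n ℝ)
    (hG : G.PosSemidef) (hN : N.PosSemidef) : Function.Injective (1 + G * N).mulVec := by
  -- (1 + GN)u = 0 ⇒ GNu = -u ⇒ ⟨Nu, G Nu⟩ = -⟨u, Nu⟩; lhs ≥ 0 ≥ rhs ⇒ ⟨u,Nu⟩ = 0 ⇒ Nu = 0 ⇒ u = 0.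
  have key : ∀ u : n → ℝ, (1 + G * N) *ᵥ u = 0 → u = 0 := by
    intro u hu
    have h1 : u + G *ᵥ (N *ᵥ u) = 0 := by
      simpa [Matrix.add_mulVec, ← Matrix.mulVec_mulVec] using hu
    have h2 : G *ᵥ (N *ᵥ u) = -u := eq_neg_of_add_eq_zero_right h1
    have hGq : 0 ≤ (N *ᵥ u) ⬝ᵥ (G *ᵥ (N *ᵥ u)) := by
      have := hG.dotProduct_mulVec_nonneg (N *ᵥ u)
      simpa using this
    have hNq : 0 ≤ u ⬝ᵥ (N *ᵥ u) := by
      have := hN.dotProduct_mulVec_nonneg u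
      simpa using this
    have hsym : (N *ᵥ u) ⬝ᵥ u = u ⬝ᵥ (N *ᵥ u) := dotProduct_comm _ _
    have h3 : (N *ᵥ u) ⬝ᵥ (G *ᵥ (N *ᵥ u)) = -(u ⬝ᵥ (N *ᵥ u)) := by
      rw [h2, dotProduct_neg, hsym]
    have h4 : u ⬝ᵥ (N *ᵥ u) = 0 := by linarith
    have h5 : N *ᵥ u = 0 := by
      have h4' : star u ⬝ᵥ (N *ᵥ u) = 0 := by simpa using h4
      exact (hN.dotProduct_mulVec_zero_iff u).1 h4'
    have h6 : G *ᵥ (N *ᵥ u) = 0 := by rw [h5, Matrix.mulVec_zero]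
    have h7 : -u = 0 := by rw [← h2, h6]
    exact neg_eq_zero.1 h7
  intro v w hvw
  have h : (1 + G * N) *ᵥ (v - w) = 0 := by
    rw [Matrix.mulVec_sub]
    exact sub_eq_zero.2 hvw
  exact sub_eq_zero.1 (key _ h)

/-- **Stokes slip-layer passivity** (first PDE lemma of the card, statement): for a smooth pair
`(u, p)` on the closed layer `0 ≤ z ≤ h`, `1`-periodic in `x, y`, solving the Stokes system
`Δu = ∇p`, `div u = 0` in the open layer, with perfect slip at `z = 0` (`u₂ = 0`, `∂₂u₀ = ∂₂u₁ = 0`)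
and purely normal lid velocity (`u₀ = u₁ = 0` at `z = h`), the lid pressure works against injection:
`∫_{cell×{h}} p u₂ = -∫_{cell×[0,h]} |∇u|²` (so the injection-to-pressure map `w = -u₂ ↦ p|_{lid}`
is a positive operator; its long-wave symbol is the Hele-Shaw stiffness `3/(h³|ξ|²)`, its
short-wave symbol the Stokes Dirichlet-to-Neumann symbol `~2|ξ|`).  Proof on paper: multiply by `u`,
integrate by parts; the slip face and the periodic faces contribute nothing, on the lid
`∂₂u₂ = -∂₀u₀ - ∂₁u₁ = 0`. [folklore] -/
def StokesLayerPassivity : Prop :=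
  ∀ (u : E³ → E³) (p : E³ → ℝ) (h : ℝ), 0 < h →
    ContDiff ℝ ((⊤ : ℕ∞) : WithTop ℕ∞) u → ContDiff ℝ ((⊤ : ℕ∞) : WithTop ℕ∞) p →
    (∀ X : E³, u (X + EuclideanSpace.single 0 (1 : ℝ)) = u X ∧ u (X + EuclideanSpace.single 1 (1 : ℝ)) = u X ∧
      p (X + EuclideanSpace.single 0 (1 : ℝ)) = p X ∧ p (X + EuclideanSpace.single 1 (1 : ℝ)) = p X) →
    (∀ X : E³, 0 < X 2 → X 2 < h →
      ∑ i : Fin 3, fderiv ℝ (fun Y => fderiv ℝ u Y (EuclideanSpace.single i (1 : ℝ))) X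
        (EuclideanSpace.single i (1 : ℝ)) = gradient p X) →
    (∀ X : E³, ∑ i : Fin 3, (fderiv ℝ u X (EuclideanSpace.single i (1 : ℝ))) i = 0) →
    (∀ X : E³, X 2 = 0 → (u X) 2 = 0 ∧ (fderiv ℝ u X (EuclideanSpace.single 2 (1 : ℝ))) 0 = 0 ∧
      (fderiv ℝ u X (EuclideanSpace.single 2 (1 : ℝ))) 1 = 0) →
    (∀ X : E³, X 2 = h → (u X) 0 = 0 ∧ (u X) 1 = 0) →
    (∫ q in Set.Icc (0 : ℝ) 1 ×ˢ Set.Icc (0 : ℝ) 1, p !₂[q.1, q.2, h] * (u !₂[q.1, q.2, h]) 2) =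
      - ∫ X in {X : E³ | X 0 ∈ Set.Icc (0 : ℝ) 1 ∧ X 1 ∈ Set.Icc (0 : ℝ) 1 ∧ X 2 ∈ Set.Icc (0 : ℝ) h},
          ∑ i : Fin 3, ‖fderiv ℝ u X (EuclideanSpace.single i (1 : ℝ))‖ ^ 2

/-- **Steady Navier–Stokes layer head passivity** (statement): same geometry, full steady NS
`(u·∇)u + ∇p = Δu` in the open layer; then the lid TOTAL HEAD works against injection:
`∫_{cell×{h}} (p + |u|²/2) u₂ = -∫ |∇u|²`.  Exact for EVERY steady solution (it is the energy
balance: head drop × flux = dissipation); what is NOT claimed is incremental monotonicity of the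
NS cap response between two solutions (open at cap Reynolds number `O(1)`, TRIAGE r1-2/r1-3 "B3").
[folklore] -/
def NSLayerHeadPassivity : Prop :=
  ∀ (u : E³ → E³) (p : E³ → ℝ) (h : ℝ), 0 < h →
    ContDiff ℝ ((⊤ : ℕ∞) : WithTop ℕ∞) u → ContDiff ℝ ((⊤ : ℕ∞) : WithTop ℕ∞) p →
    (∀ X : E³, u (X + EuclideanSpace.single 0 (1 : ℝ)) = u X ∧ u (X + EuclideanSpace.single 1 (1 : ℝ)) = u X ∧
      p (X + EuclideanSpace.single 0 (1 : ℝ)) = p X ∧ p (X + EuclideanSpace.single 1 (1 : ℝ)) = p X) →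
    (∀ X : E³, 0 < X 2 → X 2 < h →
      (fderiv ℝ u X) (u X) + gradient p X =
        ∑ i : Fin 3, fderiv ℝ (fun Y => fderiv ℝ u Y (EuclideanSpace.single i (1 : ℝ))) X
          (EuclideanSpace.single i (1 : ℝ))) →
    (∀ X : E³, ∑ i : Fin 3, (fderiv ℝ u X (EuclideanSpace.single i (1 : ℝ))) i = 0) →
    (∀ X : E³, X 2 = 0 → (u X) 2 = 0 ∧ (fderiv ℝ u X (EuclideanSpace.single 2 (1 : ℝ))) 0 = 0 ∧
      (fderiv ℝ u X (EuclideanSpace.single 2 (1 : ℝ))) 1 = 0) →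
    (∀ X : E³, X 2 = h → (u X) 0 = 0 ∧ (u X) 1 = 0) →
    (∫ q in Set.Icc (0 : ℝ) 1 ×ˢ Set.Icc (0 : ℝ) 1,
        (p !₂[q.1, q.2, h] + ‖u !₂[q.1, q.2, h]‖ ^ 2 / 2) * (u !₂[q.1, q.2, h]) 2) =
      - ∫ X in {X : E³ | X 0 ∈ Set.Icc (0 : ℝ) 1 ∧ X 1 ∈ Set.Icc (0 : ℝ) 1 ∧ X 2 ∈ Set.Icc (0 : ℝ) h},
          ∑ i : Fin 3, ‖fderiv ℝ u X (EuclideanSpace.single i (1 : ℝ))‖ ^ 2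

end Summit.AnomalousDissipation.AnomalousDissipation.Cruxes.ViscousContinuation.SketchR2K4
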